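import Literature.Algebra.Lie.OrthogonalAlgebraSimple
import Mathlib.Algebra.Lie.CartanCriterion
import Mathlib.Algebra.Lie.Killing
import HarnessLib

/-!
# `𝔬(4) = D_2` is semisimple: no abelian ideals in `typeD l K` for `|l| = 2`, and `𝔰𝔬(U, B)` for split `B` of dimension `4` (Humphreys §6 Ex. 5(b); the exceptional dimension of Looijenga–Lunts (7.5))

Topic `Literature/Algebra/Lie` (namespace `Literature.Algebra.Lie.OrthogonalSemisimpleTypeDTwo`).  Lane `lit-hodgefound`
(Track 2 foundations library), Layer A1, skeleton seat `lit-hodgefound-skel-1` (generation 50), row **A1-180** of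
`run/shared/lean/pub/lit-hodgefound/SKELETON.md`.  Rows A1-168/169 (`OrthogonalSimpleTypeD.lean`) prove that
`𝔬(2l, K) = typeD l K` is SIMPLE for `|l| ≥ 3`; row A1-165 shows that for `|l| = 2` it is NOT simple (two commuting
`3`-dimensional ideals).  This file supplies the positive statement in the exceptional dimension: `𝔬(4, K)` has NO
non-zero ABELIAN ideal (`LieAlgebra.HasTrivialRadical`, any field with `2 ≠ 0`), hence is SEMISIMPLE in characteristic
`0` by Cartan's criterion as packaged in Mathlib (`LieAlgebra.HasTrivialRadical.instIsKilling`,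
`LieAlgebra.IsKilling.instSemisimple`), and the basis-free transport to `𝔰𝔬(U, B)` for a `B` with a hyperbolic basis
of size `4` (in particular `V ⊕ V^*`, `dim V = 2`, of [LooijengaLunts1997, §3]) and for `dim U = 4` over an
algebraically closed field.  THEOREMS ONLY; no definition, no named fact, no `sorry` (net debt `0`); no instance, no
notation (the Lie bracket of matrices / endomorphisms is the commutator through local `letI` inside proofs only).

## Sources

* [Humphreys1972] §6 Exercise 5(b), p. 30 (held chunk p0047 L7): "If `L` is a classical linear Lie algebra (1.2), then `L`
  is semisimple."; §1 Exercise 10, p. 6 (held chunk p0019 L11): "What can you say about `D_2`?" (`D_2 = A_1 × A_1`);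
  §1.2 p. 4 (the basis of `D_ℓ`), §19.2.
* [LooijengaLunts1997] §3 p. 13: "(𝔰𝔬(V ⊕ V^*), u) is a Jordan–Lefschetz pair" — by (2.2) the total Lie algebra of a
  Jordan–Lefschetz pair is semisimple; for `dim V = 2` this is the present `D_2` case, which the simplicity rows
  (A1-168 … A1-173, `dim V ≥ 3`) do not cover; Appendix (7.5), p. 28 L86–L90 (the exception `dim U = 4`).

## Proof (§2)

Let `P ⊆ typeD l K` (`|l| = 2`, `l = {a, b}`) be a `K`-subspace stable under `m ↦ Ym - mY` (`Y ∈ 𝔬(4)`) on which the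
commutator vanishes identically.  (A) If some member had a non-zero off-diagonal-BLOCK entry, rows A1-168's sandwich
lemmas (`nsub_mem_of_apply_inr_inl_ne_zero`, `…_inl_inr_…`) put a root vector `n_{ab}` in `P`, then
`h_a + h_b = [p_{ab}, n_{ab}] ∈ P`, and `[n_{ab}, h_a + h_b] = -2n_{ab} ≠ 0` contradicts commutativity (`nsub_notMem`).
(B) If some member had `X_{ba} ≠ 0`, the sandwich `m(E_{ab}) X m(E_{ab}) = X_{ba} m(E_{ab})` puts `m(E_{ab})` in `P`,
then `h_b - h_a = [m(E_{ba}), m(E_{ab})] ∈ P` and `[m(E_{ab}), h_b - h_a] = 2m(E_{ab}) ≠ 0` (`msub_notMem`).  (C) So all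
members are diagonal; for `X ∈ P` the members `[n_{ab}, X]`, `[m(E_{ab}), X]` have entries `-(X_{aa} + X_{bb})` at
`(a, b')` and `X_{bb} - X_{aa}` at `(a, b)`, which vanish by (A), (B); so `X = 0` (`2 ≠ 0`).

## Contents (all proved)

* §1 `msub_swap_comm_msub` (`[m(E_{vu}), m(E_{uv})] = h_v - h_u`), `msub_comm_h_right` (`[m(E_{uv}), h_v] = m(E_{uv})`),
  `msub_comm_h_sub_h` (`[m(E_{uv}), h_v - h_u] = 2m(E_{uv})`), entries `nsub_comm_apply_inl_inr`, `msub_comm_apply_inl_inl`;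
* §2 `nsub_notMem`, `msub_notMem`, `apply_inr_inl_eq_zero`, `apply_inl_inr_eq_zero`, `apply_inl_inl_eq_zero`,
  **`eq_bot_of_forall_comm_mem_of_forall_mul_comm`** (the core);
* §3 **`hasTrivialRadical_typeD`** (`2 ≠ 0`, `|l| = 2`), **`isSemisimple_typeD`** (characteristic `0`),
  `isSemisimple_typeD_fin_two`, `hasTrivialRadical_typeD_fin_two`;
* §4 basis-free: `eq_bot_of_core` (transport of an "abelian ⇒ 0" matrix core through `X ↦ [X]_b`),
  `eq_bot_of_forall_lie_mem_of_toMatrix_eq_JD`, **`hasTrivialRadical_skewAdjoint_of_toMatrix_eq_JD`**,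
  **`isSemisimple_skewAdjoint_of_toMatrix_eq_JD`** (a basis with Gram `JD m K`, `|m| = 2`),
  **`isSemisimple_skewAdjoint_of_finrank_eq_four`**, `hasTrivialRadical_skewAdjoint_of_finrank_eq_four` (algebraically
  closed `K`, `B` non-degenerate symmetric, `dim U = 4`).

## Scope

The decomposition `D_2 = A_1 × A_1` itself (an explicit Lie algebra isomorphism) is not constructed (row A1-165 has the
two ideals); real anisotropic / Lorentzian signatures are not treated.  Nothing here is a case of the Hodge conjecture.
-/

namespace Literature.Algebra.Lie.OrthogonalSemisimpleTypeDTwo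

open LieAlgebra LieAlgebra.Orthogonal Matrix Sum OrthogonalSimpleTypeD

variable {l : Type*} [Fintype l] [DecidableEq l] {R : Type*} [CommRing R] {K : Type*} [Field K]

/-- Matrix units: `E_{pq}E_{rs} = 0` for `q ≠ r`. [folklore] -/
private theorem E_mul_E_of_ne {ι : Type*} [Fintype ι] [DecidableEq ι] {p q r s : ι} (h : q ≠ r) :
    single p q (1 : R) * single r s (1 : R) = 0 :=
  single_mul_single_of_ne _ _ _ _ h _

/-- Matrix units: `E_{pq}E_{qs} = E_{ps}`. [folklore] -/
private theorem E_mul_E {ι : Type*} [Fintype ι] [DecidableEq ι] (p q s : ι) :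
    single p q (1 : R) * single q s (1 : R) = single p s 1 := by
  rw [single_mul_single_same, mul_one]

/-- Mixed products `E_{p,a'} E_{b,s} = 0`. [folklore] -/
private theorem E_inr_mul_E_inl (p s : l ⊕ l) (a b : l) :
    single p (inr a) (1 : R) * single (inl b) s (1 : R) = 0 :=
  single_mul_single_of_ne _ _ _ _ inr_ne_inl _

/-- Mixed products `E_{p,a} E_{b',s} = 0`. [folklore] -/
private theorem E_inl_mul_E_inr (p s : l ⊕ l) (a b : l) :
    single p (inl a) (1 : R) * single (inr b) s (1 : R) = 0 :=
  single_mul_single_of_ne _ _ _ _ inl_ne_inr _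

/-! ### §1 Two more brackets of Humphreys' basis and two entries [Humphreys1972, §1.2, §19.2] -/

/-- `[m(E_{vu}), m(E_{uv})] = h_v - h_u` for `u ≠ v` (the coroot of the short `𝔰𝔩₂` `⟨m(E_{uv}), m(E_{vu}), h_u - h_v⟩`).
[cite: Humphreys1972, §1.2 p. 4 (type D_ℓ), §19.2] -/
theorem msub_swap_comm_msub (u v : l) :
    (single (inl v) (inl u) (1 : R) - single (inr u) (inr v) 1) * (single (inl u) (inl v) (1 : R) - single (inr v) (inr u) 1)
        - (single (inl u) (inl v) (1 : R) - single (inr v) (inr u) 1) * (single (inl v) (inl u) (1 : R) - single (inr u) (inr v) 1)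
      = (single (inl v) (inl v) 1 - single (inr v) (inr v) 1) - (single (inl u) (inl u) 1 - single (inr u) (inr u) 1) := by
  simp only [Matrix.sub_mul, Matrix.mul_sub, E_mul_E, E_inr_mul_E_inl, E_inl_mul_E_inr]
  abel

/-- `[m(E_{uv}), h_v] = m(E_{uv})` for `u ≠ v`. [cite: Humphreys1972, §1.2 p. 4 (type D_ℓ), §19.2] -/
theorem msub_comm_h_right {u v : l} (huv : u ≠ v) :
    (single (inl u) (inl v) (1 : R) - single (inr v) (inr u) 1) * (single (inl v) (inl v) (1 : R) - single (inr v) (inr v) 1)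
        - (single (inl v) (inl v) (1 : R) - single (inr v) (inr v) 1) * (single (inl u) (inl v) (1 : R) - single (inr v) (inr u) 1)
      = single (inl u) (inl v) 1 - single (inr v) (inr u) 1 := by
  have hvu : (inl v : l ⊕ l) ≠ inl u := fun h => huv (inl_injective h).symm
  have huv' : (inr u : l ⊕ l) ≠ inr v := fun h => huv (inr_injective h)
  simp only [Matrix.sub_mul, Matrix.mul_sub, E_mul_E, E_mul_E_of_ne hvu, E_mul_E_of_ne huv', E_inr_mul_E_inl,
    E_inl_mul_E_inr]
  abel

/-- `[m(E_{uv}), h_v - h_u] = 2 m(E_{uv})` for `u ≠ v`. [cite: Humphreys1972, §1.2 p. 4 (type D_ℓ), §19.2] -/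
theorem msub_comm_h_sub_h {u v : l} (huv : u ≠ v) :
    (single (inl u) (inl v) (1 : R) - single (inr v) (inr u) 1)
          * ((single (inl v) (inl v) (1 : R) - single (inr v) (inr v) 1) - (single (inl u) (inl u) 1 - single (inr u) (inr u) 1))
        - ((single (inl v) (inl v) (1 : R) - single (inr v) (inr v) 1) - (single (inl u) (inl u) 1 - single (inr u) (inr u) 1))
          * (single (inl u) (inl v) (1 : R) - single (inr v) (inr u) 1)
      = (2 : R) • (single (inl u) (inl v) (1 : R) - single (inr v) (inr u) 1) := by
  have h1 := msub_comm_h_right (R := R) huv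
  have h2 := msub_comm_h (R := R) huv
  rw [two_smul]
  calc _ = ((single (inl u) (inl v) (1 : R) - single (inr v) (inr u) 1) * (single (inl v) (inl v) (1 : R) - single (inr v) (inr v) 1)
        - (single (inl v) (inl v) (1 : R) - single (inr v) (inr v) 1) * (single (inl u) (inl v) (1 : R) - single (inr v) (inr u) 1))
        - ((single (inl u) (inl v) (1 : R) - single (inr v) (inr u) 1) * (single (inl u) (inl u) (1 : R) - single (inr u) (inr u) 1)
        - (single (inl u) (inl u) (1 : R) - single (inr u) (inr u) 1) * (single (inl u) (inl v) (1 : R) - single (inr v) (inr u) 1)) := by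
          noncomm_ring
    _ = _ := by rw [h1, h2]; abel

/-- The entry `([n_{ab}, X])_{a,b'} = X_{b'b'} - X_{aa}` (`a ≠ b`). [cite: Humphreys1972, §1.2 p. 4 (type D_ℓ), §19.2] -/
theorem nsub_comm_apply_inl_inr {a b : l} (hab : a ≠ b) (X : Matrix (l ⊕ l) (l ⊕ l) R) :
    (((single (inl a) (inr b) (1 : R) - single (inl b) (inr a) 1) * X
        - X * (single (inl a) (inr b) (1 : R) - single (inl b) (inr a) 1) : Matrix (l ⊕ l) (l ⊕ l) R)) (inl a) (inr b)
      = X (inr b) (inr b) - X (inl a) (inl a) := by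
  have hab' : (inl a : l ⊕ l) ≠ inl b := fun h => hab (inl_injective h)
  have hba' : (inr b : l ⊕ l) ≠ inr a := fun h => hab (inr_injective h).symm
  rw [Matrix.sub_apply, Matrix.sub_mul, Matrix.mul_sub, Matrix.sub_apply, Matrix.sub_apply, single_mul_apply_same,
    single_mul_apply_of_ne (h := hab'), mul_single_apply_same, mul_single_apply_of_ne (hbj := hba'), one_mul, mul_one,
    sub_zero, sub_zero]

/-- The entry `([m(E_{ab}), X])_{a,b} = X_{bb} - X_{aa}`. [cite: Humphreys1972, §1.2 p. 4 (type D_ℓ), §19.2] -/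
theorem msub_comm_apply_inl_inl (a b : l) (X : Matrix (l ⊕ l) (l ⊕ l) R) :
    (((single (inl a) (inl b) (1 : R) - single (inr b) (inr a) 1) * X
        - X * (single (inl a) (inl b) (1 : R) - single (inr b) (inr a) 1) : Matrix (l ⊕ l) (l ⊕ l) R)) (inl a) (inl b)
      = X (inl b) (inl b) - X (inl a) (inl a) := by
  rw [Matrix.sub_apply, Matrix.sub_mul, Matrix.mul_sub, Matrix.sub_apply, Matrix.sub_apply, single_mul_apply_same,
    single_mul_apply_of_ne (h := inl_ne_inr), mul_single_apply_same, mul_single_apply_of_ne (hbj := inl_ne_inr), one_mul,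
    mul_one, sub_zero, sub_zero]

/-! ### §2 Abelian `ad 𝔬(2l)`-stable subspaces of `𝔬(2l)` -/

section stable

variable {P : Submodule K (Matrix (l ⊕ l) (l ⊕ l) K)}

/-- If `P ⊆ 𝔬(2l)` is `ad 𝔬(2l)`-stable and ABELIAN, it contains no root vector `n_{ab}` (`a ≠ b`, `2 ≠ 0`): otherwise
`h_a + h_b = [p_{ab}, n_{ab}] ∈ P` and `[h_a + h_b, n_{ab}] = 2n_{ab} ≠ 0`. [cite: Humphreys1972, §1.2 p. 4, §19.2] -/
theorem nsub_notMem (h2 : (2 : K) ≠ 0) {a b : l} (hab : a ≠ b)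
    (hP : ∀ ⦃Y m : Matrix (l ⊕ l) (l ⊕ l) K⦄, Y ∈ typeD l K → m ∈ P → Y * m - m * Y ∈ P)
    (hPA : ∀ ⦃m m' : Matrix (l ⊕ l) (l ⊕ l) K⦄, m ∈ P → m' ∈ P → m * m' = m' * m) :
    (single (inl a) (inr b) (1 : K) - single (inl b) (inr a) 1 : Matrix (l ⊕ l) (l ⊕ l) K) ∉ P := by
  intro hn
  have hp := single_inr_inl_sub_mem_typeD (R := K) a b
  have hh := hP hp hn
  rw [psub_comm_nsub hab] at hh
  have hcomm := hPA hn hh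
  have h0 := nsub_comm_h_add_h (R := K) hab
  rw [hcomm, sub_self] at h0
  have h1 : (2 : K) • (single (inl a) (inr b) (1 : K) - single (inl b) (inr a) 1 : Matrix (l ⊕ l) (l ⊕ l) K) = 0 := by
    rw [← neg_eq_zero, ← h0]
  have h2' := (smul_eq_zero.1 h1).resolve_left h2
  have h3 := congrArg (fun M : Matrix (l ⊕ l) (l ⊕ l) K => M (inl a) (inr b)) h2'
  have hba : b ≠ a := hab.symm
  simp [Matrix.sub_apply, hba] at h3

/-- If `P ⊆ 𝔬(2l)` is `ad 𝔬(2l)`-stable and ABELIAN, it contains no `m(E_{ab})` (`a ≠ b`, `2 ≠ 0`): otherwise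
`h_b - h_a = [m(E_{ba}), m(E_{ab})] ∈ P` and `[m(E_{ab}), h_b - h_a] = 2m(E_{ab}) ≠ 0`. [cite: Humphreys1972, §1.2 p. 4, §19.2] -/
theorem msub_notMem (h2 : (2 : K) ≠ 0) {a b : l} (hab : a ≠ b)
    (hP : ∀ ⦃Y m : Matrix (l ⊕ l) (l ⊕ l) K⦄, Y ∈ typeD l K → m ∈ P → Y * m - m * Y ∈ P)
    (hPA : ∀ ⦃m m' : Matrix (l ⊕ l) (l ⊕ l) K⦄, m ∈ P → m' ∈ P → m * m' = m' * m) :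
    (single (inl a) (inl b) (1 : K) - single (inr b) (inr a) 1 : Matrix (l ⊕ l) (l ⊕ l) K) ∉ P := by
  intro hm
  have hm' := single_inl_inl_sub_single_inr_inr_mem_typeD (R := K) b a
  have hh := hP hm' hm
  rw [msub_swap_comm_msub] at hh
  have hcomm := hPA hm hh
  have h0 := msub_comm_h_sub_h (R := K) hab
  rw [hcomm, sub_self] at h0
  have h2' := (smul_eq_zero.1 h0.symm).resolve_left h2
  have h3 := congrArg (fun M : Matrix (l ⊕ l) (l ⊕ l) K => M (inl a) (inl b)) h2'
  simp [Matrix.sub_apply] at h3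

/-- Step A: in an abelian `ad 𝔬(2l)`-stable `P ⊆ 𝔬(2l)` every member has ZERO lower-left block.
[cite: Humphreys1972, §2 Exercise 6, §19.2] -/
theorem apply_inr_inl_eq_zero (h2 : (2 : K) ≠ 0)
    (hP : ∀ ⦃Y m : Matrix (l ⊕ l) (l ⊕ l) K⦄, Y ∈ typeD l K → m ∈ P → Y * m - m * Y ∈ P)
    (hPD : ∀ ⦃m : Matrix (l ⊕ l) (l ⊕ l) K⦄, m ∈ P → m ∈ typeD l K)
    (hPA : ∀ ⦃m m' : Matrix (l ⊕ l) (l ⊕ l) K⦄, m ∈ P → m' ∈ P → m * m' = m' * m)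
    {X : Matrix (l ⊕ l) (l ⊕ l) K} (hXP : X ∈ P) (i j : l) : X (inr i) (inl j) = 0 := by
  by_contra hne
  obtain ⟨hji, hn⟩ := nsub_mem_of_apply_inr_inl_ne_zero h2 hP (hPD hXP) hXP hne
  exact nsub_notMem h2 hji hP hPA hn

/-- Step A': … and ZERO upper-right block. [cite: Humphreys1972, §2 Exercise 6, §19.2] -/
theorem apply_inl_inr_eq_zero (h2 : (2 : K) ≠ 0)
    (hP : ∀ ⦃Y m : Matrix (l ⊕ l) (l ⊕ l) K⦄, Y ∈ typeD l K → m ∈ P → Y * m - m * Y ∈ P)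
    (hPD : ∀ ⦃m : Matrix (l ⊕ l) (l ⊕ l) K⦄, m ∈ P → m ∈ typeD l K)
    (hPA : ∀ ⦃m m' : Matrix (l ⊕ l) (l ⊕ l) K⦄, m ∈ P → m' ∈ P → m * m' = m' * m)
    {X : Matrix (l ⊕ l) (l ⊕ l) K} (hXP : X ∈ P) (i j : l) : X (inl i) (inr j) = 0 := by
  by_contra hne
  obtain ⟨hji, hn⟩ := nsub_mem_of_apply_inl_inr_ne_zero h2 hP (hPD hXP) hXP hne
  exact nsub_notMem h2 hji hP hPA hn

/-- Step B: … and ZERO off-diagonal entries in the upper-left block (by the sandwich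
`m(E_{ab}) X m(E_{ab}) = X_{ba} m(E_{ab})`). [cite: Humphreys1972, §2 Exercise 6, §19.2] -/
theorem apply_inl_inl_eq_zero (h2 : (2 : K) ≠ 0)
    (hP : ∀ ⦃Y m : Matrix (l ⊕ l) (l ⊕ l) K⦄, Y ∈ typeD l K → m ∈ P → Y * m - m * Y ∈ P)
    (hPD : ∀ ⦃m : Matrix (l ⊕ l) (l ⊕ l) K⦄, m ∈ P → m ∈ typeD l K)
    (hPA : ∀ ⦃m m' : Matrix (l ⊕ l) (l ⊕ l) K⦄, m ∈ P → m' ∈ P → m * m' = m' * m)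
    {X : Matrix (l ⊕ l) (l ⊕ l) K} (hXP : X ∈ P) {a b : l} (hab : a ≠ b) : X (inl b) (inl a) = 0 := by
  by_contra hne
  have hm := single_inl_inl_sub_single_inr_inr_mem_typeD (R := K) a b
  have h1 := hP hm (hP hm hXP)
  rw [comm_comm_eq_of_mul_self_eq_zero (msub_mul_self (R := K) hab), msub_mul_mul_msub_of_mem_typeD h2 (hPD hXP), smul_smul,
    ← neg_smul] at h1
  exact msub_notMem h2 hab hP hPA ((P.smul_mem_iff (neg_ne_zero.2 (mul_ne_zero h2 hne))).1 h1)

/-- **The core (`D_2 = A_1 × A_1` is semisimple)**: for `2 ≠ 0` in `K` and `|l| = 2`, an ABELIAN `K`-subspace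
`P ⊆ 𝔬(4, K) = typeD l K` stable under `m ↦ Ym - mY` for all `Y ∈ 𝔬(4, K)` is `0` — `𝔬(4)` has no non-zero abelian
ideal although it is not simple (`𝔬(4) = I₊ ⊕ I₋`, two commuting copies of `𝔰𝔩₂`). Steps A, B leave diagonal members
only, and for a diagonal `X ∈ P` the entries `([n_{ab}, X])_{ab'} = -(X_{aa} + X_{bb})` and
`([m(E_{ab}), X])_{ab} = X_{bb} - X_{aa}` of members of `P` vanish, so `X = 0`.
[cite: Humphreys1972, §6 Exercise 5(b) p. 30 ("a classical linear Lie algebra is semisimple"), §1 Exercise 10 p. 6 (D_2), §1.2 p. 4, §19.2; LooijengaLunts1997, §3 p. 13 ("(𝔰𝔬(V ⊕ V^*), u) is a Jordan–Lefschetz pair", hence semisimple)] -/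
theorem eq_bot_of_forall_comm_mem_of_forall_mul_comm (h2 : (2 : K) ≠ 0) {a b : l} (hab : a ≠ b)
    (hl : ∀ x : l, x = a ∨ x = b)
    (hP : ∀ ⦃Y m : Matrix (l ⊕ l) (l ⊕ l) K⦄, Y ∈ typeD l K → m ∈ P → Y * m - m * Y ∈ P)
    (hPD : ∀ ⦃m : Matrix (l ⊕ l) (l ⊕ l) K⦄, m ∈ P → m ∈ typeD l K)
    (hPA : ∀ ⦃m m' : Matrix (l ⊕ l) (l ⊕ l) K⦄, m ∈ P → m' ∈ P → m * m' = m' * m) : P = ⊥ := by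
  rw [eq_bot_iff]
  intro X hXP
  rw [Submodule.mem_bot]
  have hXD := hPD hXP
  -- the two diagonal relations
  have hsum : X (inl a) (inl a) + X (inl b) (inl b) = 0 := by
    have hZ := hP (single_inl_inr_sub_mem_typeD (R := K) a b) hXP
    have h := apply_inl_inr_eq_zero h2 hP hPD hPA hZ a b
    rw [nsub_comm_apply_inl_inr hab, apply_inr_inr_of_mem_typeD hXD] at h
    linear_combination -h
  have hdiff : X (inl b) (inl b) - X (inl a) (inl a) = 0 := by
    have hZ := hP (single_inl_inl_sub_single_inr_inr_mem_typeD (R := K) a b) hXP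
    have h := apply_inl_inl_eq_zero h2 hP hPD hPA hZ hab.symm
    rwa [msub_comm_apply_inl_inl] at h
  have haa : X (inl a) (inl a) = 0 := by
    have h : (2 : K) * X (inl a) (inl a) = 0 := by linear_combination hsum - hdiff
    exact (mul_eq_zero.1 h).resolve_left h2
  have hbb : X (inl b) (inl b) = 0 := by linear_combination hsum - haa
  have hdiag : ∀ u : l, X (inl u) (inl u) = 0 := fun u => by
    rcases hl u with rfl | rfl
    · exact haa
    · exact hbb
  have hoff : ∀ u v : l, X (inl u) (inl v) = 0 := by
    intro u v
    by_cases huv : u = v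
    · subst huv
      exact hdiag u
    · exact apply_inl_inl_eq_zero h2 hP hPD hPA hXP (Ne.symm huv)
  ext p q
  rcases p with u | u <;> rcases q with v | v
  · exact hoff u v
  · exact apply_inl_inr_eq_zero h2 hP hPD hPA hXP u v
  · exact apply_inr_inl_eq_zero h2 hP hPD hPA hXP u v
  · rw [apply_inr_inr_of_mem_typeD hXD, hoff, neg_zero, Matrix.zero_apply]

end stable

/-! ### §3 `𝔬(4, K)` has trivial radical and is semisimple -/

/-- **`𝔬(4, K) = typeD l K` (`|l| = 2`, `2 ≠ 0`) has no non-zero abelian ideal**, i.e. trivial solvable radical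
(Mathlib `hasTrivialRadical_iff_no_abelian_ideals`). [cite: Humphreys1972, §6 Exercise 5(b) p. 30 ("a classical linear Lie algebra is semisimple"), §1 Exercise 10 p. 6 (D_2)] -/
theorem hasTrivialRadical_typeD (h2 : (2 : K) ≠ 0) {a b : l} (hab : a ≠ b) (hl : ∀ x : l, x = a ∨ x = b) :
    LieAlgebra.HasTrivialRadical K (typeD l K) := by
  classical
  letI : LieRing (Matrix (l ⊕ l) (l ⊕ l) K) := LieRing.ofAssociativeRing
  letI : LieAlgebra K (Matrix (l ⊕ l) (l ⊕ l) K) := LieAlgebra.ofAssociativeAlgebra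
  rw [LieAlgebra.hasTrivialRadical_iff_no_abelian_ideals]
  intro I hI
  set P : Submodule K (Matrix (l ⊕ l) (l ⊕ l) K) := (I : Submodule K (typeD l K)).map (typeD l K).toSubmodule.subtype
    with hPdef
  have hPmem : ∀ {m : Matrix (l ⊕ l) (l ⊕ l) K}, m ∈ P ↔ ∃ hm : m ∈ typeD l K, (⟨m, hm⟩ : typeD l K) ∈ I := by
    intro m
    rw [hPdef, Submodule.mem_map]
    constructor
    · rintro ⟨y, hy, rfl⟩
      exact ⟨y.2, hy⟩
    · rintro ⟨hm, hmI⟩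
      exact ⟨⟨m, hm⟩, hmI, rfl⟩
  have hP : ∀ ⦃Y m : Matrix (l ⊕ l) (l ⊕ l) K⦄, Y ∈ typeD l K → m ∈ P → Y * m - m * Y ∈ P := by
    intro Y m hY hm
    obtain ⟨hm, hmI⟩ := hPmem.1 hm
    have h := I.lie_mem (x := (⟨Y, hY⟩ : typeD l K)) hmI
    exact hPmem.2 ⟨_, h⟩
  have hPD : ∀ ⦃m : Matrix (l ⊕ l) (l ⊕ l) K⦄, m ∈ P → m ∈ typeD l K := fun m hm => (hPmem.1 hm).1
  have hPA : ∀ ⦃m m' : Matrix (l ⊕ l) (l ⊕ l) K⦄, m ∈ P → m' ∈ P → m * m' = m' * m := by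
    intro m m' hm hm'
    obtain ⟨hmD, hmI⟩ := hPmem.1 hm
    obtain ⟨hm'D, hm'I⟩ := hPmem.1 hm'
    have h := hI.trivial ⟨⟨m, hmD⟩, hmI⟩ ⟨⟨m', hm'D⟩, hm'I⟩
    have h' : (⁅(⟨m, hmD⟩ : typeD l K), (⟨m', hm'D⟩ : typeD l K)⁆ : typeD l K) = 0 := by
      have := congr_arg (fun z : I => ((z : I) : typeD l K)) h
      simpa using this
    have h'' := congr_arg (fun z : typeD l K => (z : Matrix (l ⊕ l) (l ⊕ l) K)) h'
    simp only [LieSubalgebra.coe_bracket, ZeroMemClass.coe_zero] at h''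
    rw [Ring.lie_def, sub_eq_zero] at h''
    exact h''
  have hbot := eq_bot_of_forall_comm_mem_of_forall_mul_comm h2 hab hl hP hPD hPA
  rw [eq_bot_iff]
  intro m hm
  rw [LieSubmodule.mem_bot]
  have hmP : (m : Matrix (l ⊕ l) (l ⊕ l) K) ∈ P := hPmem.2 ⟨m.2, hm⟩
  rw [hbot, Submodule.mem_bot] at hmP
  exact Subtype.ext hmP

/-- `typeD l K` is finite-dimensional. [folklore] -/
private theorem moduleFinite_typeD : Module.Finite K (typeD l K) := by
  letI : LieRing (Matrix (l ⊕ l) (l ⊕ l) K) := LieRing.ofAssociativeRing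
  letI : LieAlgebra K (Matrix (l ⊕ l) (l ⊕ l) K) := LieAlgebra.ofAssociativeAlgebra
  exact Module.Finite.of_injective (typeD l K).toSubmodule.subtype Subtype.val_injective

/-- **`𝔬(4, K)` is semisimple** in characteristic `0` (`|l| = 2`): trivial radical plus Cartan's criterion
(Mathlib `HasTrivialRadical.instIsKilling`, `IsKilling.instSemisimple`).  It is NOT simple: `D_2 = A_1 × A_1`.
[cite: Humphreys1972, §6 Exercise 5(b) p. 30, §1 Exercise 10 p. 6; LooijengaLunts1997, §3 p. 13] -/
theorem isSemisimple_typeD [CharZero K] {a b : l} (hab : a ≠ b) (hl : ∀ x : l, x = a ∨ x = b) :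
    LieAlgebra.IsSemisimple K (typeD l K) := by
  haveI := moduleFinite_typeD (l := l) (K := K)
  haveI := hasTrivialRadical_typeD (K := K) two_ne_zero hab hl
  infer_instance

/-- `𝔬(4, K) = typeD (Fin 2) K` is semisimple in characteristic `0`. [cite: Humphreys1972, §6 Exercise 5(b) p. 30, §1 Exercise 10 p. 6] -/
theorem isSemisimple_typeD_fin_two (K : Type*) [Field K] [CharZero K] : LieAlgebra.IsSemisimple K (typeD (Fin 2) K) :=
  isSemisimple_typeD (a := 0) (b := 1) (by decide) (fun x => by fin_cases x <;> simp)

/-- `typeD (Fin 2) K` has trivial radical whenever `2 ≠ 0`. [cite: Humphreys1972, §6 Exercise 5(b) p. 30, §1 Exercise 10 p. 6] -/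
theorem hasTrivialRadical_typeD_fin_two (K : Type*) [Field K] (h2 : (2 : K) ≠ 0) :
    LieAlgebra.HasTrivialRadical K (typeD (Fin 2) K) :=
  hasTrivialRadical_typeD h2 (a := 0) (b := 1) (by decide) (fun x => by fin_cases x <;> simp)

/-! ### §4 Basis-free: `𝔰𝔬(U, B)` for a split `B` of dimension `4` has trivial radical and is semisimple -/

section Transport

variable {V : Type*} [AddCommGroup V] [Module K V] {B : LinearMap.BilinForm K V}

open Module in
/-- **Transport of an "abelian ⇒ zero" matrix core**: if, in the coordinates of a basis `b` (Gram matrix `G`), every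
abelian `K`-subspace of `G`-skew matrices stable under `m ↦ Ym - mY` (`Y` `G`-skew) is `0`, then every abelian
`ad(𝔰𝔬(U, B))`-stable `K`-subspace of `𝔰𝔬(U, B) = B.skewAdjointSubmodule` is `⊥` (through the algebra isomorphism
`X ↦ [X]_b`, rows A1-166/171/175). [cite: Humphreys1972, §1.2 p. 4, §19.2] -/
theorem eq_bot_of_core {n : Type*} [Fintype n] [DecidableEq n] (b : Basis n K V)
    (core : ∀ P' : Submodule K (Matrix n n K),
      (∀ ⦃Y m : Matrix n n K⦄, (LinearMap.BilinForm.toMatrix b B).IsSkewAdjoint Y → m ∈ P' → Y * m - m * Y ∈ P') →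
      (∀ ⦃m : Matrix n n K⦄, m ∈ P' → (LinearMap.BilinForm.toMatrix b B).IsSkewAdjoint m) →
      (∀ ⦃m m' : Matrix n n K⦄, m ∈ P' → m' ∈ P' → m * m' = m' * m) → P' = ⊥)
    {P : Submodule K (Module.End K V)} (hP : P ≤ B.skewAdjointSubmodule)
    (hstab : ∀ a ∈ B.skewAdjointSubmodule, ∀ x ∈ P, ⁅a, x⁆ ∈ P)
    (hPA : ∀ x ∈ P, ∀ y ∈ P, x * y = y * x) : P = ⊥ := by
  classical
  have hsk : ∀ X : Module.End K V,
      X ∈ B.skewAdjointSubmodule ↔ (LinearMap.BilinForm.toMatrix b B).IsSkewAdjoint (LinearMap.toMatrix b b X) :=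
    fun X ↦ SymplecticAlgebraSimple.mem_skewAdjointSubmodule_iff_isSkewAdjoint_toMatrix b B X
  let Φ : Module.End K V ≃ₗ[K] Matrix n n K := LinearMap.toMatrix b b
  have hΦmul : ∀ X Y : Module.End K V, Φ (X * Y) = Φ X * Φ Y := fun X Y ↦ LinearMap.toMatrix_mul b X Y
  let P' : Submodule K (Matrix n n K) := P.map (Φ : Module.End K V →ₗ[K] Matrix n n K)
  have hP'mem : ∀ m, m ∈ P' ↔ Φ.symm m ∈ P := fun m ↦ Submodule.mem_map_equiv (e := Φ) (p := P)
  have hP'sk : ∀ ⦃m : Matrix n n K⦄, m ∈ P' → (LinearMap.BilinForm.toMatrix b B).IsSkewAdjoint m := by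
    intro m hm
    have h := (hsk _).1 (hP ((hP'mem m).1 hm))
    rwa [LinearEquiv.apply_symm_apply] at h
  have hP'stab : ∀ ⦃Y m : Matrix n n K⦄, (LinearMap.BilinForm.toMatrix b B).IsSkewAdjoint Y → m ∈ P' →
      Y * m - m * Y ∈ P' := by
    intro Y m hY hm
    have hY' : Φ.symm Y ∈ B.skewAdjointSubmodule := by
      rw [hsk, LinearEquiv.apply_symm_apply]
      exact hY
    have h := hstab _ hY' _ ((hP'mem m).1 hm)
    rw [Ring.lie_def] at h
    rw [hP'mem]
    have hsymm_eq : Φ.symm (Y * m - m * Y) = Φ.symm Y * Φ.symm m - Φ.symm m * Φ.symm Y := by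
      apply Φ.injective
      rw [LinearEquiv.apply_symm_apply, map_sub, hΦmul, hΦmul, LinearEquiv.apply_symm_apply,
        LinearEquiv.apply_symm_apply]
    rw [hsymm_eq]
    exact h
  have hP'A : ∀ ⦃m m' : Matrix n n K⦄, m ∈ P' → m' ∈ P' → m * m' = m' * m := by
    intro m m' hm hm'
    have h := hPA _ ((hP'mem m).1 hm) _ ((hP'mem m').1 hm')
    have h' := congr_arg Φ h
    rw [hΦmul, hΦmul, LinearEquiv.apply_symm_apply, LinearEquiv.apply_symm_apply] at h'
    exact h'
  have h0 := core P' hP'stab hP'sk hP'A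
  rw [eq_bot_iff]
  intro x hxP
  rw [Submodule.mem_bot]
  have hX : Φ x ∈ P' := (hP'mem _).2 (by rw [LinearEquiv.symm_apply_apply]; exact hxP)
  rw [h0, Submodule.mem_bot] at hX
  exact (LinearEquiv.map_eq_zero_iff Φ).1 hX

open Module in
/-- **A basis with Gram matrix `JD m K`, `|m| = 2` (`dim U = 4`, the hyperbolic space `H ⊥ H`), `2 ≠ 0`**: every abelian
`ad(𝔰𝔬(U, B))`-stable `K`-subspace of `𝔰𝔬(U, B)` is `⊥`. [cite: Humphreys1972, §1.2 p. 4 (type D_ℓ), §19.2] -/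
theorem eq_bot_of_forall_lie_mem_of_toMatrix_eq_JD [NeZero (2 : K)] {m : Type*} [Fintype m] [DecidableEq m]
    (b : Basis (m ⊕ m) K V) (hb : LinearMap.BilinForm.toMatrix b B = JD m K) {a c : m} (hac : a ≠ c)
    (hl : ∀ x : m, x = a ∨ x = c)
    {P : Submodule K (Module.End K V)} (hP : P ≤ B.skewAdjointSubmodule)
    (hstab : ∀ a ∈ B.skewAdjointSubmodule, ∀ x ∈ P, ⁅a, x⁆ ∈ P) (hPA : ∀ x ∈ P, ∀ y ∈ P, x * y = y * x) : P = ⊥ := by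
  refine eq_bot_of_core b (fun P' hst hsk hA ↦ ?_) hP hstab hPA
  rw [hb] at hst hsk
  exact eq_bot_of_forall_comm_mem_of_forall_mul_comm (P := P') (NeZero.ne 2) hac hl
    (fun Y n hY hn ↦ hst ((OrthogonalSimpleTypeD.isSkewAdjoint_JD_iff_mem_typeD Y).2 hY) hn)
    (fun n hn ↦ (OrthogonalSimpleTypeD.isSkewAdjoint_JD_iff_mem_typeD n).1 (hsk hn)) hA

open Module in
/-- **`𝔰𝔬(U, B)` has trivial radical** for `B` with a basis of Gram matrix `JD m K`, `|m| = 2` (`2 ≠ 0`): no non-zero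
abelian Lie ideal of the Lie subalgebra `skewAdjointLieSubalgebra B` of `𝔤𝔩(U)`.
[cite: Humphreys1972, §6 Exercise 5(b) p. 30, §1 Exercise 10 p. 6, §1.2 p. 4; LooijengaLunts1997, §3 p. 13] -/
theorem hasTrivialRadical_skewAdjoint_of_toMatrix_eq_JD [NeZero (2 : K)] {m : Type*} [Fintype m] [DecidableEq m]
    (b : Basis (m ⊕ m) K V) (hb : LinearMap.BilinForm.toMatrix b B = JD m K) {a c : m} (hac : a ≠ c)
    (hl : ∀ x : m, x = a ∨ x = c) : LieAlgebra.HasTrivialRadical K (skewAdjointLieSubalgebra B) := by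
  classical
  letI : LieRing (Module.End K V) := LieRing.ofAssociativeRing
  letI : LieAlgebra K (Module.End K V) := LieAlgebra.ofAssociativeAlgebra
  rw [LieAlgebra.hasTrivialRadical_iff_no_abelian_ideals]
  intro I hI
  set P : Submodule K (Module.End K V) :=
    (I : Submodule K (skewAdjointLieSubalgebra B)).map (skewAdjointLieSubalgebra B).toSubmodule.subtype with hPdef
  have hPmem : ∀ {x : Module.End K V}, x ∈ P ↔
      ∃ hx : x ∈ skewAdjointLieSubalgebra B, (⟨x, hx⟩ : skewAdjointLieSubalgebra B) ∈ I := by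
    intro x
    rw [hPdef, Submodule.mem_map]
    constructor
    · rintro ⟨y, hy, rfl⟩
      exact ⟨y.2, hy⟩
    · rintro ⟨hx, hxI⟩
      exact ⟨⟨x, hx⟩, hxI, rfl⟩
  have hP : P ≤ B.skewAdjointSubmodule := fun x hx ↦ (hPmem.1 hx).1
  have hstab : ∀ a ∈ B.skewAdjointSubmodule, ∀ x ∈ P, ⁅a, x⁆ ∈ P := by
    intro a ha x hx
    obtain ⟨hx, hxI⟩ := hPmem.1 hx
    have h := I.lie_mem (x := (⟨a, ha⟩ : skewAdjointLieSubalgebra B)) hxI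
    exact hPmem.2 ⟨_, h⟩
  have hPA : ∀ x ∈ P, ∀ y ∈ P, x * y = y * x := by
    intro x hx y hy
    obtain ⟨hxS, hxI⟩ := hPmem.1 hx
    obtain ⟨hyS, hyI⟩ := hPmem.1 hy
    have h := hI.trivial ⟨⟨x, hxS⟩, hxI⟩ ⟨⟨y, hyS⟩, hyI⟩
    have h' : (⁅(⟨x, hxS⟩ : skewAdjointLieSubalgebra B), (⟨y, hyS⟩ : skewAdjointLieSubalgebra B)⁆ :
        skewAdjointLieSubalgebra B) = 0 := by
      have := congr_arg (fun z : I => ((z : I) : skewAdjointLieSubalgebra B)) h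
      simpa using this
    have h'' := congr_arg (fun z : skewAdjointLieSubalgebra B => (z : Module.End K V)) h'
    simp only [LieSubalgebra.coe_bracket, ZeroMemClass.coe_zero] at h''
    rw [Ring.lie_def, sub_eq_zero] at h''
    exact h''
  have hbot := eq_bot_of_forall_lie_mem_of_toMatrix_eq_JD b hb hac hl hP hstab hPA
  rw [eq_bot_iff]
  intro x hx
  rw [LieSubmodule.mem_bot]
  have hxP : (x : Module.End K V) ∈ P := hPmem.2 ⟨x.2, hx⟩
  rw [hbot, Submodule.mem_bot] at hxP
  exact Subtype.ext hxP

/-- `skewAdjointLieSubalgebra B` is finite-dimensional when `V` is. [folklore] -/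
private theorem moduleFinite_skewAdjoint [FiniteDimensional K V] : Module.Finite K (skewAdjointLieSubalgebra B) := by
  letI : LieRing (Module.End K V) := LieRing.ofAssociativeRing
  letI : LieAlgebra K (Module.End K V) := LieAlgebra.ofAssociativeAlgebra
  exact Module.Finite.of_injective (skewAdjointLieSubalgebra B).toSubmodule.subtype Subtype.val_injective

open Module in
/-- **`𝔰𝔬(U, B)` is semisimple** (characteristic `0`) for `B` with a basis of Gram matrix `JD m K`, `|m| = 2` — e.g.
`V ⊕ V^*` with `q(x, ξ) = ξ(x)` and `dim V = 2` [LooijengaLunts1997, §3]: Cartan's criterion (Mathlib) on top of the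
trivial radical. [cite: Humphreys1972, §6 Exercise 5(b) p. 30, §1 Exercise 10 p. 6; LooijengaLunts1997, §3 p. 13 ("(𝔰𝔬(V ⊕ V^*), u) is a Jordan–Lefschetz pair")] -/
theorem isSemisimple_skewAdjoint_of_toMatrix_eq_JD [CharZero K] [FiniteDimensional K V] {m : Type*} [Fintype m]
    [DecidableEq m] (b : Basis (m ⊕ m) K V) (hb : LinearMap.BilinForm.toMatrix b B = JD m K) {a c : m} (hac : a ≠ c)
    (hl : ∀ x : m, x = a ∨ x = c) : LieAlgebra.IsSemisimple K (skewAdjointLieSubalgebra B) := by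
  haveI := moduleFinite_skewAdjoint (K := K) (B := B)
  haveI := hasTrivialRadical_skewAdjoint_of_toMatrix_eq_JD b hb hac hl
  infer_instance

open Module in
/-- **`dim U = 4` over an algebraically closed field of characteristic `0`** (e.g. `ℂ`): for a non-degenerate symmetric
`B` on a `4`-dimensional `U`, `𝔰𝔬(U, B) ≅ 𝔰𝔩₂ × 𝔰𝔩₂` is semisimple (row A1-171's hyperbolic basis, `m = 2`) — the
exceptional dimension of Looijenga–Lunts (7.5), where `𝔰𝔬(U)` is semisimple but not simple.
[cite: Humphreys1972, §6 Exercise 5(b) p. 30, §1 Exercise 10 p. 6; LooijengaLunts1997, Appendix (7.5), p. 28 L86–L90] -/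
theorem isSemisimple_skewAdjoint_of_finrank_eq_four [IsAlgClosed K] [CharZero K] [FiniteDimensional K V]
    (hB : B.Nondegenerate) (hs : ∀ u v : V, B u v = B v u) (hdim : finrank K V = 4) :
    LieAlgebra.IsSemisimple K (skewAdjointLieSubalgebra B) := by
  obtain ⟨b, hb⟩ := OrthogonalAlgebraSimple.exists_basis_toMatrix_eq_JD hB hs (m := 2) (by rw [hdim])
  exact isSemisimple_skewAdjoint_of_toMatrix_eq_JD b hb (a := 0) (c := 1) (by decide) (fun x => by fin_cases x <;> simp)

open Module in
/-- The same with trivial radical spelled out (`2 ≠ 0` suffices). [cite: Humphreys1972, §6 Exercise 5(b) p. 30, §1 Exercise 10 p. 6] -/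
theorem hasTrivialRadical_skewAdjoint_of_finrank_eq_four [IsAlgClosed K] [NeZero (2 : K)] [FiniteDimensional K V]
    (hB : B.Nondegenerate) (hs : ∀ u v : V, B u v = B v u) (hdim : finrank K V = 4) :
    LieAlgebra.HasTrivialRadical K (skewAdjointLieSubalgebra B) := by
  obtain ⟨b, hb⟩ := OrthogonalAlgebraSimple.exists_basis_toMatrix_eq_JD hB hs (m := 2) (by rw [hdim])
  exact hasTrivialRadical_skewAdjoint_of_toMatrix_eq_JD b hb (a := 0) (c := 1) (by decide)
    (fun x => by fin_cases x <;> simp)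

end Transport

end Literature.Algebra.Lie.OrthogonalSemisimpleTypeDTwo
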